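import Summits.ABC.IUTFork.Repair.RHHullCapacityNecessaryMassCeilingLicence
import HarnessLib

/-!
# R-H row 3 «hull-capacity-necessary» — `RHHullCapacityNecessaryMassEnvelope`: the FLOOR that the row-3 mass CEILING (p483256) is tight against,
# its degenerate / one-place instances, the «μ = 1» end, the knife-edge sharpness of `+3`, and the maximal licensed stratum at the genuine datum

PROOF-ONLY leaf file of the abc-iut cell (D-0079 RESCUE sub-cell R-H, rung LADDER-ABC:A2.RESCUE.H). Content AUTHORED by the row-3 TESTER
abc-iut-rh-tst-3 (gen 6; kernel probe `HOME/abc-iut-rh-tst-3/gen6/MassCeilingProbe.lean` sha16 a808a25672ef5a20, farm rc 0, offered block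
`staging/RH/abc-iut-rh-tst-3/MassCeilingFloor.append-block.lean`), FILED by the row-3 typer lineage abc-iut-rh-typ-3 (gen 8) — refuter seats do
not file under `Repair/`. TAKES NO SIDE on [IUTchIII] Cor. 3.12 or on any author; nothing here asserts abc; H⋆₃ / its cells / Σ-strata / the
licence mass are HYPOTHESES and BOOKKEEPING about OUR typed objects, read BY NAME: `RHHullCapacityNecessaryTyped.CellAt`/`HStar` (p458118),
Σ₃ = `RH.SigmaStrataEq.sigmaED` (p470530), the type-free bracket `RHHullCapacityNecessaryBracket.cellAt_of_le_floorIdx` /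
`not_cellAt_of_floorIdx_add_two_le` (p480462; index `I(x₀) = ⌊(d+a+b+c)/(P_q/e)⌋₊`), the licence-mass bookkeeping `RH.SigmaMass.onTrivialMass` /
`offTrivialMass` / `totalTrivialMass` (abc-iut-rh2-T-1), the segment law `RH.CellWeights.mass_labelSegment_eq` (abc-iut-rh2-w-1), the ceiling
`RHHullCapacityNecessaryMassCeiling.onTrivialMass_le_of_subset_sigmaED` (p483256) and its genuine-datum sequel
`RHHullCapacityNecessaryMassCeilingLicence.offTrivialMass_pos_of_licenceOn` (p483723), `RH.SigmaStrataEq.licenceCells_subset_sigmaED` (p471090).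

WHY THIS FILE. p483256 proved the CEILING: every `σ ⊆ Σ₃` keeps at most `(Σᶠ_{v_ℚ} S(j₀(v_ℚ))·h(v_ℚ))/l⋆` of licence mass for every
bracket-certified cut `j₀` (`S(n) = n(n−1)(2n+5)/6 = Σ_{j ≤ n}(j²−1)`, `h(v_ℚ) = −qLocal`), with `j₀(p) = I(x₀)+2` admissible at a bad `x₀ | p`.
This file supplies THE OTHER SIDE OF THE ENVELOPE and the boundary cases, at the same bed `settingPrVolSharp X` (realising ideles), binders
VERBATIM from p483256: §3 **`finsum_le_onTrivialMass_sigmaED`** — every label window `{i+1 ≤ j₁(v_ℚ)}` with `j₁ ≤ l⋆` and `j₁(p) ≤ I(x₀)+1` at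
EVERY bad `x₀ | p` lies INSIDE Σ₃ (p480462's lower end), hence `(Σᶠ S(j₁)·h)/l⋆ ≤ mass(Σ₃)`; so per packet the slice of Σ₃ is SANDWICHED
`S(min(l⋆, I⁻_p+1)) ≤ · ≤ S(min(l⋆, I_p+2))` (`I⁻_p` the minimum over the bad fibre over `p`) — the envelope is one boundary label (+ the spread of
`I` over the fibre) wide; **`ceiling_trivial_cut`** (C0: `j₀ ≡ l⋆` is certified vacuously and returns `mass(σ) ≤ M` — consistent, nothing junk);
**`ceiling_one_place`** (C1: one bad place and one cut value `J` certify `update (fun _ ↦ l⋆) p J`); **`onTrivialMass_sigmaED_eq_total_of_hStar`**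
(C3: the «μ = 1» end is exactly H⋆₃). §1 records why `hx : x₀ ∈ S` in the certification is load-bearing (**`floorIdx_eq_zero_of_not_mem`**: at a
GOOD place `μ = 0` so `I = 0`, yet **`cellAt_of_not_mem`**: every cell holds there). §2 records that `+3` in p483256's strict-deficit theorem
cannot be lowered to `+2`: the tame knife-edge packet `p = 17`, `e = 195`, `m_q = 120`, `l = 13` has `I = 4 = l⋆ − 2` and its TOP label `j = 6`
HOLDS (**`knife_edge_p17_e195_m120`**, `_all`; integer dictionary `RHHullCapacityNecessaryInt.IntCell`, p463493; tester census: 474 wild / 57 tame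
knife-edge patterns on the beds of record). §4, at the genuine `K`-level bed `pilotDataOfK D K` (binders VERBATIM from p483723): the MAXIMAL
licensed stratum `licenceCells` has mass under Σ₃'s (**`onTrivialMass_licenceCells_le_sigmaED`**) and CONCEDES a positive off-mass as soon as one
bad place is deep, `I(x₀)+3 ≤ l⋆` (**`offTrivialMass_licenceCells_pos`**). PROOF-ONLY (0 defs).
[cite: Mochizuki2012, IUTchIV Prop. 1.2 (i)(ii) p. 10; IUTchIII Cor. 3.12 pp. 173–174] [cite: DupuyHilado2025, §3.3, §4 (intro)]
[claim: Mochizuki2012, status: disputed] for every IUT locution. typed ≠ proved; computed ≠ proved; locator ≠ «S holds».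
-/

noncomputable section

open Set Function NumberField IsDedekindDomain
open scoped Pointwise

namespace Summit.ABC.IUTFork.Repair.RHHullCapacityNecessaryMassEnvelope

open Literature.AnabelianGeometry.AbsoluteAnabelian Literature.IUT.LogThetaLattice Literature.IUT.LogVolume
  Literature.IUT.HodgeTheaters Literature.IUT.LogVolume.ThetaData Literature.NumberTheory.NumberFields
  Literature.NumberTheory.GaloisRepresentations.Ultrametric
open Summit.ABC.IUTFork.Thm311 Summit.ABC.IUTFork.Thm311.Real Summit.ABC.IUTFork.Cor312 Summit.ABC.IUTFork.Cor312.Setting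
  Summit.ABC.IUTFork.Cor312Vol Summit.ABC.IUTFork.Cor312Vol.ExplicitDepth Summit.ABC.IUTFork.Cor312Prov
  Summit.ABC.IUTFork.Repair.RHHullCapacityNecessaryTyped Summit.ABC.IUTFork.Repair.RHHullCapacityNecessaryAnti
  Summit.ABC.IUTFork.Repair.RHHullCapacityNecessaryBracket Summit.ABC.IUTFork.Repair.RHHullCapacityNecessaryInt
  Summit.ABC.IUTFork.Repair.RH.SigmaLicence Summit.ABC.IUTFork.Repair.RH.SigmaStrataEq Summit.ABC.IUTFork.Repair.RH.SigmaMass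
  Summit.ABC.IUTFork.Repair.RH.CellWeights Summit.ABC.IUTFork.Repair.RHHullCapacityNecessaryMassCeiling

/-! ## §1. At a GOOD place the bracket index is `0` (`μ = 0`) and every cell holds: why `hx : x₀ ∈ S` is load-bearing in the certification -/
section Good

variable {F : Type} [Field F] [NumberField F] (X : PilotData F) {logv : PadicLogs F} (hlog : LogvAnalytic logv)

/-- **At a GOOD place the bracket index vanishes**: `x₀ ∉ S ⟹ μ(x₀) = P_q(x₀)/e = 0 ⟹ I(x₀) = ⌊κ/0⌋₊ = 0`. So a «certification» read at a
good place would cut every packet at the label `j₀ = 2` — which is why the certification hypothesis of p483256 / §3 below carries `hx : x₀ ∈ S`.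
[claim: Mochizuki2012, status: disputed] -/
theorem floorIdx_eq_zero_of_not_mem (pp : Nat.Primes) (x₀ : (thetaIndex X).Fibre (.inr pp))
    (hx : haveI : Fact (pp : ℕ).Prime := ⟨pp.2⟩; placeOf X pp.1 x₀ ∉ X.S) :
    haveI : Fact (pp : ℕ).Prime := ⟨pp.2⟩
    ⌊(differentOrd (pp : ℕ) (kOf X pp.1 x₀) + logRadiusA (pp : ℕ) (absRamificationIdx (pp : ℕ) (kOf X pp.1 x₀))
          + logRadiusB (pp : ℕ) (absRamificationIdx (pp : ℕ) (kOf X pp.1 x₀)) + (((if (pp : ℕ) = 2 then 2 else 1 : ℕ)) : ℝ)) /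
        (X.qPilot (placeOf X pp.1 x₀) / (ramIdx F (placeOf X pp.1 x₀) : ℝ))⌋₊ = 0 := by
  haveI : Fact (pp : ℕ).Prime := ⟨pp.2⟩
  rw [X.qPilot_apply_of_not_mem hx, zero_div, div_zero, Nat.floor_zero]

/-- … and yet EVERY [ED] cell HOLDS at a good place: `μ = 0` makes the floor-free linear test of `RH.Q3LTail.cellAt_of_linear` read
`0 ≤ κ`, and `κ ≥ 1` (`RHHullCapacityNecessaryBracket.one_le_depthCapacity`). [claim: Mochizuki2012, status: disputed] -/
theorem cellAt_of_not_mem (pp : Nat.Primes) (i₀ : Fin (thetaIndex X).lstar) (x₀ : (thetaIndex X).Fibre (.inr pp))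
    (hx : haveI : Fact (pp : ℕ).Prime := ⟨pp.2⟩; placeOf X pp.1 x₀ ∉ X.S) : CellAt X hlog pp i₀ x₀ := by
  haveI : Fact (pp : ℕ).Prime := ⟨pp.2⟩
  apply Summit.ABC.IUTFork.Repair.RH.Q3LTail.cellAt_of_linear X hlog pp i₀ x₀
  rw [X.qPilot_apply_of_not_mem hx, zero_div, mul_zero]
  linarith [one_le_depthCapacity (pp : ℕ) (kOf X pp.1 x₀)]

end Good

/-! ## §2. `+3` in the strict-deficit theorem of p483256 is sharp: a tame knife-edge packet with `l⋆ = I + 2` wholly IN Σ₃ -/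
section KnifeEdge

/-- **The smallest TAME knife-edge packet** (tester census `HOME/abc-iut-rh-tst-3/gen6/row3_ceiling_k3.out`: 474 wild / 57 tame patterns with
`l⋆ = I + 2` and the whole place IN Σ₃): `p = 17`, `e = 195 = 15·13`, `m_q = 120`, tame different `D = 194`, `l = 13`, `l⋆ = 6`; in the integer
dictionary of p463493, `I = (195·(B+2) + A − 2)/120 = 4` (`A = aWin 17 195 = 13`, `B = bWin 17 195 = 1`), so `l⋆ = I + 2` — and the TOP label
`j = 6` (cell index `i₀ = 5 = I + 1`, the one free label of the bracket) HOLDS while `j = 7 = I + 3` fails (as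
`RHHullCapacityNecessaryBracket.not_cellAt_of_floorIdx_add_two_le` says it must). Hence the hypothesis `I(x₀) + 3 ≤ l⋆` of
`RHHullCapacityNecessaryMassCeiling.offTrivialMass_pos_of_subset_sigmaED` cannot be weakened to `I(x₀) + 2 ≤ l⋆`: this packet concedes nothing.
Pure `decide` on closed integer terms. [folklore] -/
theorem knife_edge_p17_e195_m120 : (195 * (bWin 17 195 + 2) + aWin 17 195 - 2) / 120 = 4 ∧ IntCell 17 195 120 6 ∧ ¬ IntCell 17 195 120 7 := by
  refine ⟨?_, ?_, ?_⟩
  · unfold aWin bWin; decide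
  · unfold IntCell aWin bWin; decide
  · unfold IntCell aWin bWin; decide

/-- … and every lower label of that packet holds too (labels `1 … 6` = the whole procession at `l = 13`): the place lies wholly in Σ₃'s integer
shadow `IntCell 17 195 120`. Pure `decide`. [folklore] -/
theorem knife_edge_p17_e195_m120_all : ∀ j ∈ Finset.Icc 1 6, IntCell 17 195 120 j := by
  unfold IntCell aWin bWin; decide

end KnifeEdge

/-! ## §3. The envelope at the bed `settingPrVolSharp X` (realising ideles; binders VERBATIM from p483256) -/
section Bed

variable {F : Type} [Field F] [NumberField F] (X : PilotData F) {logv : PadicLogs F} (hlog : LogvAnalytic logv)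
  (M : Type) [Field M] [NumberField M]
  (archPk : ∀ (j : (thetaIndex X).Label) (vQ : (thetaIndex X).VQ), Set ((logShellsDH X logv).Packet j vQ))
  (archSub : ∀ (j : (thetaIndex X).Label) (v : (thetaIndex X).V),
    Set ((logShellsDH X logv).Packet j ((thetaIndex X).over v)))
  (Ψ : ℤ → ∀ v : (thetaIndex X).V, v ∈ (thetaIndex X).Vbad → Set ((logShellsDH X logv).StarPacket v))
  (act : ℤ → ∀ v : (thetaIndex X).V, v ∈ (thetaIndex X).Vbad →
    (logShellsDH X logv).StarPacket v → Module.End ℚ ((logShellsDH X logv).StarPacket v))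
  (Mmod : ℤ → ∀ j : (thetaIndex X).LabelStar, Set ((logShellsDH X logv).GlobalPacket j.1))
  (region : ℤ → ∀ j : (thetaIndex X).LabelStar, FinDivisor M → ∀ vQ : (thetaIndex X).VQ,
    Set ((logShellsDH X logv).Packet j.1 vQ))
  (n : ℤ) {HT : Type} {LogLink : HT → HT → Type} {IsFull : ∀ {s t : HT}, LogLink s t → Prop}
  (lat : LGPGaussianLogThetaLattice LogLink IsFull)
  {Frd : Type} {IsoF : Frd → Frd → Type} {Ob : Frd → Type} {realify : Frd → Frd} {Strip : Type}
  {IsoS : Strip → Strip → Type} {Mv : ∀ v : (thetaIndex X).V, v ∈ (thetaIndex X).Vbad → Type}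
  [∀ v h, Monoid (Mv v h)]
  (sig : GlobalLGPFrobenioidSignature (thetaIndex X).lstar (thetaIndex X).V (· ∈ (thetaIndex X).Vbad)
    Frd IsoF Ob realify Strip IsoS Mv)
  (split : SplittingMonoids Mv) {ObΔ : Type} {N : ∀ v : (thetaIndex X).V, v ∈ (thetaIndex X).Vbad → Type}
  [∀ v h, Monoid (N v h)] (qData : QPilotData ObΔ N)
  (tq : ∀ (pp : Nat.Primes) (x : (thetaIndex X).Fibre (.inr pp)), haveI : Fact (pp : ℕ).Prime := ⟨pp.2⟩; kOf X pp.1 x)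
  (t : ∀ (pp : Nat.Primes) (_ : Fin X.lstar) (x : (thetaIndex X).Fibre (.inr pp)),
    haveI : Fact (pp : ℕ).Prime := ⟨pp.2⟩; kOf X pp.1 x)
  (htq0 : ∀ pp x, tq pp x ≠ 0)
  (htq1 : ∀ (pp : Nat.Primes) (x : (thetaIndex X).Fibre (.inr pp)),
    haveI : Fact (pp : ℕ).Prime := ⟨pp.2⟩; placeOf X pp.1 x ∉ X.S → ‖tq pp x‖ = 1)
  (ht0 : ∀ pp i x, t pp i x ≠ 0)
  (ht1 : ∀ (pp : Nat.Primes) (i : Fin X.lstar) (x : (thetaIndex X).Fibre (.inr pp)),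
    haveI : Fact (pp : ℕ).Prime := ⟨pp.2⟩; placeOf X pp.1 x ∉ X.S → ‖t pp i x‖ = 1)
  (ht : ∀ (pp : Nat.Primes) (i : Fin X.lstar) (x : (thetaIndex X).Fibre (.inr pp)),
    haveI : Fact (pp : ℕ).Prime := ⟨pp.2⟩
    Real.log ‖t pp i x‖ = -(X.thetaPilot i (placeOf X pp.1 x)) * logNorm F (placeOf X pp.1 x) / localDegree F (placeOf X pp.1 x))
  (htq : ∀ (pp : Nat.Primes) (x : (thetaIndex X).Fibre (.inr pp)),
    haveI : Fact (pp : ℕ).Prime := ⟨pp.2⟩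
    Real.log ‖tq pp x‖ = -(X.qPilot (placeOf X pp.1 x)) * logNorm F (placeOf X pp.1 x) / localDegree F (placeOf X pp.1 x))

include ht0 ht1 ht htq in
/-- **C0, the DEGENERATE cut.** `j₀ ≡ l⋆` is certified vacuously (no packet is cut) and p483256's ceiling then reads `mass(σ) ≤ M`
(`M = totalTrivialMass`) for every `σ ⊆ Σ₃` — consistent, nothing junk. [claim: Mochizuki2012, status: disputed] -/
theorem ceiling_trivial_cut (σ : Set (Fin (thetaIndex X).lstar × (thetaIndex X).VQ)) (hσ : σ ⊆ sigmaED X hlog) (i₀ : Fin (thetaIndex X).lstar) :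
    onTrivialMass (settingPrVolSharp X hlog M archPk archSub Ψ act Mmod region n lat sig split qData tq t htq0 htq1) σ ≤ totalTrivialMass (settingPrVolSharp X hlog M archPk archSub Ψ act Mmod region n lat sig split qData tq t htq0 htq1) := by
  have h := onTrivialMass_le_of_subset_sigmaED X hlog M archPk archSub Ψ act Mmod region n lat sig split qData tq t htq0 htq1 ht0 ht1 ht htq
    (j₀ := fun _ => (thetaIndex X).lstar) (fun _ => le_rfl) (fun vQ hlt => absurd hlt (lt_irrefl _)) σ hσ i₀
  rw [totalTrivialMass_settingPrVolSharp_eq_finsum X hlog M archPk archSub Ψ act Mmod region n lat sig split qData tq t htq0 htq1 ht0 ht htq i₀]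
  exact h

open Classical in
include ht0 ht1 ht htq in
/-- **C1, the ONE-PLACE ceiling.** One bad `x₀ | p` and one cut value `J ≤ l⋆` with `J < l⋆ → I(x₀) + 2 ≤ J` certify the cut
`j₀ = update (fun _ ↦ l⋆) p J`, so every `σ ⊆ Σ₃` has `mass(σ) ≤ [S(l⋆)·Σ_{v_ℚ ≠ p} h(v_ℚ) + S(J)·h(p)]/l⋆`. [claim: Mochizuki2012, status: disputed] -/
theorem ceiling_one_place (pp : Nat.Primes) (x₀ : (thetaIndex X).Fibre (.inr pp))
    (hx : haveI : Fact (pp : ℕ).Prime := ⟨pp.2⟩; placeOf X pp.1 x₀ ∈ X.S) {J : ℕ} (hJl : J ≤ (thetaIndex X).lstar)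
    (hJ : J < (thetaIndex X).lstar →
      haveI : Fact (pp : ℕ).Prime := ⟨pp.2⟩
      ⌊(differentOrd (pp : ℕ) (kOf X pp.1 x₀) + logRadiusA (pp : ℕ) (absRamificationIdx (pp : ℕ) (kOf X pp.1 x₀))
          + logRadiusB (pp : ℕ) (absRamificationIdx (pp : ℕ) (kOf X pp.1 x₀)) + (((if (pp : ℕ) = 2 then 2 else 1 : ℕ)) : ℝ)) /
        (X.qPilot (placeOf X pp.1 x₀) / (ramIdx F (placeOf X pp.1 x₀) : ℝ))⌋₊ + 2 ≤ J)
    (σ : Set (Fin (thetaIndex X).lstar × (thetaIndex X).VQ)) (hσ : σ ⊆ sigmaED X hlog) (i₀ : Fin (thetaIndex X).lstar) :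
    onTrivialMass (settingPrVolSharp X hlog M archPk archSub Ψ act Mmod region n lat sig split qData tq t htq0 htq1) σ ≤
      (∑ᶠ vQ : (thetaIndex X).VQ, ((Function.update (fun _ : (thetaIndex X).VQ => (thetaIndex X).lstar) (Sum.inr pp) J vQ : ℕ) : ℝ) *
          ((Function.update (fun _ : (thetaIndex X).VQ => (thetaIndex X).lstar) (Sum.inr pp) J vQ : ℕ) - 1) *
          (2 * (Function.update (fun _ : (thetaIndex X).VQ => (thetaIndex X).lstar) (Sum.inr pp) J vQ : ℕ) + 5) / 6 *
        (-(settingPrVolSharp X hlog M archPk archSub Ψ act Mmod region n lat sig split qData tq t htq0 htq1).qLocal (labelSucc i₀) vQ)) / (thetaIndex X).lstar := by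
  haveI : Fact (pp : ℕ).Prime := ⟨pp.2⟩
  refine onTrivialMass_le_of_subset_sigmaED X hlog M archPk archSub Ψ act Mmod region n lat sig split qData tq t htq0 htq1 ht0 ht1 ht htq
    (j₀ := Function.update (fun _ : (thetaIndex X).VQ => (thetaIndex X).lstar) (Sum.inr pp) J) ?_ ?_ σ hσ i₀
  · intro vQ
    by_cases h : vQ = Sum.inr pp
    · subst h; rw [Function.update_self]; exact hJl
    · rw [Function.update_of_ne h]
  · intro vQ hlt
    by_cases h : vQ = Sum.inr pp
    · subst h
      rw [Function.update_self] at hlt ⊢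
      exact ⟨pp, x₀, rfl, hx, hJ hlt⟩
    · rw [Function.update_of_ne h] at hlt
      exact absurd hlt (lt_irrefl _)

include ht0 ht1 ht htq in
/-- **C2, THE FLOOR FOR Σ₃** (the other side of p483256's envelope). A label window `{(i, v_ℚ) | i+1 ≤ j₁(v_ℚ)}` with `j₁ ≤ l⋆` and
`j₁(p) ≤ I(x₀) + 1` at EVERY bad `x₀ | p` lies inside Σ₃ (p480462's lower end `cellAt_of_le_floorIdx`; archimedean / bad-place-free packets: no
condition), hence `(Σᶠ_{v_ℚ} S(j₁(v_ℚ))·h(v_ℚ))/l⋆ ≤ mass(Σ₃)` (`onTrivialMass_mono` + `RH.CellWeights.mass_labelSegment_eq`). Together with the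
ceiling at `σ = Σ₃`: `S(min(l⋆, I⁻_p + 1)) ≤ [Σ₃'s packet-p slice] ≤ S(min(l⋆, I_p + 2))` — one boundary label (+ the spread of `I` over the bad
fibre over `p`) wide. [claim: Mochizuki2012, status: disputed] -/
theorem finsum_le_onTrivialMass_sigmaED {j₁ : (thetaIndex X).VQ → ℕ} (hj : ∀ vQ, j₁ vQ ≤ (thetaIndex X).lstar)
    (hfloor : ∀ (pp : Nat.Primes) (x₀ : (thetaIndex X).Fibre (.inr pp)),
      (haveI : Fact (pp : ℕ).Prime := ⟨pp.2⟩; placeOf X pp.1 x₀ ∈ X.S) →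
        haveI : Fact (pp : ℕ).Prime := ⟨pp.2⟩
        j₁ (Sum.inr pp) ≤ ⌊(differentOrd (pp : ℕ) (kOf X pp.1 x₀) + logRadiusA (pp : ℕ) (absRamificationIdx (pp : ℕ) (kOf X pp.1 x₀))
          + logRadiusB (pp : ℕ) (absRamificationIdx (pp : ℕ) (kOf X pp.1 x₀)) + (((if (pp : ℕ) = 2 then 2 else 1 : ℕ)) : ℝ)) /
        (X.qPilot (placeOf X pp.1 x₀) / (ramIdx F (placeOf X pp.1 x₀) : ℝ))⌋₊ + 1)
    (i₀ : Fin (thetaIndex X).lstar) :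
    (∑ᶠ vQ : (thetaIndex X).VQ, (j₁ vQ : ℝ) * (j₁ vQ - 1) * (2 * j₁ vQ + 5) / 6 * (-(settingPrVolSharp X hlog M archPk archSub Ψ act Mmod region n lat sig split qData tq t htq0 htq1).qLocal (labelSucc i₀) vQ)) /
        (thetaIndex X).lstar ≤
      onTrivialMass (settingPrVolSharp X hlog M archPk archSub Ψ act Mmod region n lat sig split qData tq t htq0 htq1) (sigmaED X hlog) := by
  have H := bridgeHyps_settingPrVolSharp_of_ideles X hlog M archPk archSub Ψ act Mmod region n lat sig split qData t tq ht0 ht1 htq0 htq1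
  have hq := qLocal_settingPrVolSharp_labelIndep X hlog M archPk archSub Ψ act Mmod region n lat sig split qData tq t htq0 htq1 htq
  set W : Set (Fin (thetaIndex X).lstar × (thetaIndex X).VQ) := {c | (c.1 : ℕ) + 1 ≤ j₁ c.2} with hWdef
  have hsub : W ⊆ sigmaED X hlog := by
    intro c hc qq hqq x₀ hx
    haveI : Fact (qq : ℕ).Prime := ⟨qq.2⟩
    apply cellAt_of_le_floorIdx X hlog qq c.1 x₀
    have h1 : (c.1 : ℕ) + 1 ≤ j₁ c.2 := hc
    have h2 := hfloor qq x₀ hx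
    rw [hqq] at h1
    omega
  have hW : onTrivialMass (settingPrVolSharp X hlog M archPk archSub Ψ act Mmod region n lat sig split qData tq t htq0 htq1) W =
      (∑ᶠ vQ : (thetaIndex X).VQ, (j₁ vQ : ℝ) * (j₁ vQ - 1) * (2 * j₁ vQ + 5) / 6 * (-(settingPrVolSharp X hlog M archPk archSub Ψ act Mmod region n lat sig split qData tq t htq0 htq1).qLocal (labelSucc i₀) vQ)) /
        (thetaIndex X).lstar := by
    rw [onTrivialMass_settingPrVolSharp_eq_mass X hlog M archPk archSub Ψ act Mmod region n lat sig split qData tq t htq0 htq1 ht0 ht htq W]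
    exact mass_labelSegment_eq _ (q := fun vQ => (settingPrVolSharp X hlog M archPk archSub Ψ act Mmod region n lat sig split qData tq t htq0 htq1).qLocal (labelSucc i₀) vQ) (fun i vQ => hq i i₀ vQ) hj W (fun _ _ => Iff.rfl)
  rw [← hW]
  exact onTrivialMass_mono H hsub

include ht0 ht1 in
/-- **C3, the «μ = 1» end is exactly H⋆₃**: `H⋆₃ ⟹ mass(Σ₃) = M` (Σ₃ = everything by `RH.SigmaStrataEq.hStar_iff_sigmaED_eq_univ`,
`mass(univ) + B_triv(univ) = M`, `B_triv(univ) = offTrivialMass univ = 0`). [claim: Mochizuki2012, status: disputed] -/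
theorem onTrivialMass_sigmaED_eq_total_of_hStar (h : HStar X hlog) :
    onTrivialMass (settingPrVolSharp X hlog M archPk archSub Ψ act Mmod region n lat sig split qData tq t htq0 htq1) (sigmaED X hlog) = totalTrivialMass (settingPrVolSharp X hlog M archPk archSub Ψ act Mmod region n lat sig split qData tq t htq0 htq1) := by
  have H := bridgeHyps_settingPrVolSharp_of_ideles X hlog M archPk archSub Ψ act Mmod region n lat sig split qData t tq ht0 ht1 htq0 htq1
  rw [(hStar_iff_sigmaED_eq_univ X hlog).1 h]
  have h1 := onTrivialMass_add_offTrivialMass H (Set.univ : Set (Fin (thetaIndex X).lstar × (thetaIndex X).VQ))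
  have h2 : offTrivialMass (settingPrVolSharp X hlog M archPk archSub Ψ act Mmod region n lat sig split qData tq t htq0 htq1) (Set.univ : Set (Fin (thetaIndex X).lstar × (thetaIndex X).VQ)) = 0 := by
    exact offTrivialMass_univ
  linarith

end Bed

/-! ## §4. The genuine `K`-level bed `pilotDataOfK D K` (binders VERBATIM from p483723): the MAXIMAL licensed stratum `licenceCells` -/
section BedK

variable {F K Fbar : Type} [Field F] [NumberField F] [Field K] [NumberField K] [Algebra F K] [Field Fbar]
  [Algebra F Fbar] [Algebra K Fbar] {E : WeierstrassCurve F} [E.IsElliptic] {l : ℕ} {Pb : BadPlacePredicates K}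
  (D : InitialThetaData F K Fbar E l Pb) {logv : PadicLogs K} (hlog : LogvAnalytic logv)
  (M : Type) [Field M] [NumberField M]
  (archPk : ∀ (j : (thetaIndex (pilotDataOfK D K)).Label) (vQ : (thetaIndex (pilotDataOfK D K)).VQ),
    Set ((logShellsDH (pilotDataOfK D K) logv).Packet j vQ))
  (archSub : ∀ (j : (thetaIndex (pilotDataOfK D K)).Label) (v : (thetaIndex (pilotDataOfK D K)).V),
    Set ((logShellsDH (pilotDataOfK D K) logv).Packet j ((thetaIndex (pilotDataOfK D K)).over v)))
  (Ψ : ℤ → ∀ v : (thetaIndex (pilotDataOfK D K)).V, v ∈ (thetaIndex (pilotDataOfK D K)).Vbad →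
    Set ((logShellsDH (pilotDataOfK D K) logv).StarPacket v))
  (act : ℤ → ∀ v : (thetaIndex (pilotDataOfK D K)).V, v ∈ (thetaIndex (pilotDataOfK D K)).Vbad →
    (logShellsDH (pilotDataOfK D K) logv).StarPacket v → Module.End ℚ ((logShellsDH (pilotDataOfK D K) logv).StarPacket v))
  (Mmod : ℤ → ∀ j : (thetaIndex (pilotDataOfK D K)).LabelStar, Set ((logShellsDH (pilotDataOfK D K) logv).GlobalPacket j.1))
  (region : ℤ → ∀ j : (thetaIndex (pilotDataOfK D K)).LabelStar, FinDivisor M → ∀ vQ : (thetaIndex (pilotDataOfK D K)).VQ,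
    Set ((logShellsDH (pilotDataOfK D K) logv).Packet j.1 vQ))
  (n : ℤ) {HT : Type} {LogLink : HT → HT → Type} {IsFull : ∀ {s t : HT}, LogLink s t → Prop}
  (lat : LGPGaussianLogThetaLattice LogLink IsFull)
  {Frd : Type} {IsoF : Frd → Frd → Type} {Ob : Frd → Type} {realify : Frd → Frd} {Strip : Type}
  {IsoS : Strip → Strip → Type} {Mv : ∀ v : (thetaIndex (pilotDataOfK D K)).V, v ∈ (thetaIndex (pilotDataOfK D K)).Vbad → Type}
  [∀ v h, Monoid (Mv v h)]
  (sig : GlobalLGPFrobenioidSignature (thetaIndex (pilotDataOfK D K)).lstar (thetaIndex (pilotDataOfK D K)).V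
    (· ∈ (thetaIndex (pilotDataOfK D K)).Vbad) Frd IsoF Ob realify Strip IsoS Mv)
  (split : SplittingMonoids Mv) {ObΔ : Type} {N : ∀ v : (thetaIndex (pilotDataOfK D K)).V, v ∈ (thetaIndex (pilotDataOfK D K)).Vbad → Type}
  [∀ v h, Monoid (N v h)] (qData : QPilotData ObΔ N)
  (tq : ∀ (pp : Nat.Primes) (x : (thetaIndex (pilotDataOfK D K)).Fibre (.inr pp)),
    haveI : Fact (pp : ℕ).Prime := ⟨pp.2⟩; kOf (pilotDataOfK D K) pp.1 x)
  (t : ∀ (pp : Nat.Primes) (_ : Fin (pilotDataOfK D K).lstar) (x : (thetaIndex (pilotDataOfK D K)).Fibre (.inr pp)),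
    haveI : Fact (pp : ℕ).Prime := ⟨pp.2⟩; kOf (pilotDataOfK D K) pp.1 x)
  (htq0 : ∀ pp x, tq pp x ≠ 0)
  (htq1 : ∀ (pp : Nat.Primes) (x : (thetaIndex (pilotDataOfK D K)).Fibre (.inr pp)),
    haveI : Fact (pp : ℕ).Prime := ⟨pp.2⟩; placeOf (pilotDataOfK D K) pp.1 x ∉ (pilotDataOfK D K).S → ‖tq pp x‖ = 1)
  (ht0 : ∀ pp i x, t pp i x ≠ 0)
  (ht1 : ∀ (pp : Nat.Primes) (i : Fin (pilotDataOfK D K).lstar) (x : (thetaIndex (pilotDataOfK D K)).Fibre (.inr pp)),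
    haveI : Fact (pp : ℕ).Prime := ⟨pp.2⟩; placeOf (pilotDataOfK D K) pp.1 x ∉ (pilotDataOfK D K).S → ‖t pp i x‖ = 1)
  (ht : ∀ (pp : Nat.Primes) (i : Fin (pilotDataOfK D K).lstar) (x : (thetaIndex (pilotDataOfK D K)).Fibre (.inr pp)),
    haveI : Fact (pp : ℕ).Prime := ⟨pp.2⟩
    Real.log ‖t pp i x‖ = -((pilotDataOfK D K).thetaPilot i (placeOf (pilotDataOfK D K) pp.1 x)) *
      logNorm K (placeOf (pilotDataOfK D K) pp.1 x) / localDegree K (placeOf (pilotDataOfK D K) pp.1 x))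
  (htq : ∀ (pp : Nat.Primes) (x : (thetaIndex (pilotDataOfK D K)).Fibre (.inr pp)),
    haveI : Fact (pp : ℕ).Prime := ⟨pp.2⟩
    Real.log ‖tq pp x‖ = -((pilotDataOfK D K).qPilot (placeOf (pilotDataOfK D K) pp.1 x)) *
      logNorm K (placeOf (pilotDataOfK D K) pp.1 x) / localDegree K (placeOf (pilotDataOfK D K) pp.1 x))

include ht0 ht1 ht htq in
/-- **C4a.** `mass(Σ_lic) ≤ mass(Σ₃)` at the genuine datum: the mass of the MAXIMAL licensed stratum `licenceCells` is under the [ED] stratum's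
(`RH.SigmaStrataEq.licenceCells_subset_sigmaED` + `onTrivialMass_mono`), hence under p483256's ceiling; the floor C2 is a floor for Σ₃, NOT for
Σ_lic. [claim: Mochizuki2012, status: disputed] -/
theorem onTrivialMass_licenceCells_le_sigmaED :
    onTrivialMass (settingPrVolSharp (pilotDataOfK D K) hlog M archPk archSub Ψ act Mmod region n lat sig split qData tq t htq0 htq1) (licenceCells (settingPrVolSharp (pilotDataOfK D K) hlog M archPk archSub Ψ act Mmod region n lat sig split qData tq t htq0 htq1)) ≤ onTrivialMass (settingPrVolSharp (pilotDataOfK D K) hlog M archPk archSub Ψ act Mmod region n lat sig split qData tq t htq0 htq1) (sigmaED (pilotDataOfK D K) hlog) :=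
  onTrivialMass_mono
    (bridgeHyps_settingPrVolSharp_of_ideles (pilotDataOfK D K) hlog M archPk archSub Ψ act Mmod region n lat sig split qData t tq ht0 ht1 htq0 htq1)
    (licenceCells_subset_sigmaED D hlog M archPk archSub Ψ act Mmod region n lat sig split qData tq t htq0 htq1 ht0 ht htq)

include ht0 ht1 ht htq in
/-- **C4b, THE MAXIMAL LICENSED STRATUM CONCEDES.** One deep bad place (`I(x₀) + 3 ≤ l⋆`) gives `0 < B_triv(Σ_licᶜ) = offTrivialMass Σ_lic`
(p483723's `offTrivialMass_pos_of_licenceOn` at `σ = licenceCells`, licensed by `RH.SigmaLicence.licenceOn_iff_subset_licenceCells`).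
[claim: Mochizuki2012, status: disputed] -/
theorem offTrivialMass_licenceCells_pos (pp : Nat.Primes) (x₀ : (thetaIndex (pilotDataOfK D K)).Fibre (.inr pp))
    (hx : haveI : Fact (pp : ℕ).Prime := ⟨pp.2⟩; placeOf (pilotDataOfK D K) pp.1 x₀ ∈ (pilotDataOfK D K).S)
    (hI : haveI : Fact (pp : ℕ).Prime := ⟨pp.2⟩
      ⌊(differentOrd (pp : ℕ) (kOf (pilotDataOfK D K) pp.1 x₀)
          + logRadiusA (pp : ℕ) (absRamificationIdx (pp : ℕ) (kOf (pilotDataOfK D K) pp.1 x₀))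
          + logRadiusB (pp : ℕ) (absRamificationIdx (pp : ℕ) (kOf (pilotDataOfK D K) pp.1 x₀))
          + (((if (pp : ℕ) = 2 then 2 else 1 : ℕ)) : ℝ)) /
        ((pilotDataOfK D K).qPilot (placeOf (pilotDataOfK D K) pp.1 x₀) / (ramIdx K (placeOf (pilotDataOfK D K) pp.1 x₀) : ℝ))⌋₊ + 3 ≤
        (thetaIndex (pilotDataOfK D K)).lstar) :
    0 < offTrivialMass (settingPrVolSharp (pilotDataOfK D K) hlog M archPk archSub Ψ act Mmod region n lat sig split qData tq t htq0 htq1) (licenceCells (settingPrVolSharp (pilotDataOfK D K) hlog M archPk archSub Ψ act Mmod region n lat sig split qData tq t htq0 htq1)) :=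
  offTrivialMass_pos_of_licenceOn D hlog M archPk archSub Ψ act Mmod region n lat sig split qData tq t htq0 htq1 ht0 ht1 ht htq pp x₀ hx hI _ (licenceOn_iff_subset_licenceCells.mpr subset_rfl)

end BedK

end Summit.ABC.IUTFork.Repair.RHHullCapacityNecessaryMassEnvelope

end
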